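import Summits.Ventures.HSemireg.WeilFrameRealCarrierDegrees
import Summits.Ventures.HSemireg.Mod4LeadingTermPinCriterion

/-!
# Venture HSemireg — TABLE R's `ch(O_Z)`-SHAPE ROWS ON THE REAL CARRIER AT EVERY PIN OF AN EVEN `n`: the middle entry is
# `(n+3)·C(2n,n) − 2(n+1) − 2` iff the `k × k` pin-block determinant vanishes (`k = n − 2a`), and `… − 1` otherwise

HONEST FRAMING. Part of the Lean index of the computation cell `pub-hsemireg` (seat w3-mod4-1 gen 15, W3 SPECIAL FIBRES;
MOD4-OFFSPLIT §13.30 last sentence, §13.31). The tree's real carriers and the Literature's Weil-type layer ONLY: no semiregularity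
map, no Ext group, no `∫`; nothing here says that HC / HC_CM / HC_AV holds; nothing here is a claim about any explicit variety or
cycle; no Literature fact is declared; NO definition is introduced. Imports: FILE 13 `WeilFrameRealCarrierDegrees` (built) + the pure
matrix file `Mod4LeadingTermPinCriterion` (FILE 52).

WHAT IS PROVED, for `A : AbelianVariety ℂ` of dimension `2n`, `n = a + k + a` EVEN with `k > 0` (`a < n/2` a pin index,
`k = n − 2a` the block size; the self-dual pin `k = 0` is FILE 40's `finrank_S_leading_middle_self_dual_pin`), with the Weil-type hypotheses of `finrank_S_weilType_middle`, the class
`x = Σ_{m ≤ 2n} (q_m/m!) ĥ^m + ĉ₊ + ĉ₋` with `q_m = 0` (`m < n`), `q_n ≠ 0`, ANY tail, the pin `(2n)!·(ĉ₊ĉ₋) = t·ĥ^{2n}` with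
`t = (−1)ⁿ C(n,a)² q_n²`, `μ = (−1)^a C(n,a) q_n`, and `B` the `k × k` pin block `((T_f(q) − μ)_{a+r, a+1+s})_{r,s<k}`:
* **`finrank_S_leading_middle_pin_of_det_eq_zero`** — `det B = 0` ⇒ `dim S_n(x) + 2(n+1) + 2 = (n+3)·C(2n,n)`;
* **`finrank_S_leading_middle_pin_of_det_ne_zero`** — `det B ≠ 0` ⇒ `dim S_n(x) + 2(n+1) + 1 = (n+3)·C(2n,n)`;
* **`finrank_S_leading_middle_pin_iff`** — `dim S_n(x) + 2(n+1) + 2 = (n+3)·C(2n,n) ↔ det B = 0`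
(`r_n = n + 1` by `Mod4LeadingTermMiddle`; the kernel dimension `2 ∕ 1` by `Mod4LeadingTermPinCriterion`). READING: every even-`n`
middle cell of TABLE R's `ch(O_Z)`-shape rows is now decided by ONE explicit determinant in `q_n, …, q_{2n−2a}`: `n = 4`: `478 ∕ 479`
at `q₄²` by the weight-20 quartic (`= −det B₀`, FILE 43) and at `16q₄²` by `5q₄q₆ = 3q₅²` (FILE 48); `n = 6`: `8300 ∕ 8301` at
`q₆²`, `36q₆²`, `400q₆²` by a `6 × 6`, a `4 × 4` and a `2 × 2` determinant. Everything PROVED, 0 sorry.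
References: [BuchweitzFlenner2008HH] Prop. 6.4.4; [vanGeemen1994HodgeAV] 4.9, Lemma 5.2; [BourbakiAlgebre1a3] Ch. III §8, §11 no. 9.
-/

noncomputable section

open CliffordAlgebra (contractLeft)
open ExteriorAlgebra (ι)
open Module CategoryTheory
open Literature.AlgebraicGeometry.Motives Literature.AlgebraicGeometry.HodgeTheory
open Literature.AlgebraicTopology.SingularHomology

namespace Summit.Ventures.HSemireg.WeilFrame

open Summit.Ventures.HSemireg.WedgeBridge Summit.Ventures.HSemireg.WeilCarrier Summit.Ventures.HSemireg.Mod4Carrier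
open Summit.Ventures.HSemireg.Wedge.Hankel

section RealCarrier

variable {A : AbelianVariety ℂ}

/-- **any pin of an even `n`, DEGENERATE pin block, on the real carrier** (`n = a + k + a` even, `t = (−1)ⁿ C(n,a)² q_n²`,
`det B = 0` for the `k × k` pin block `B` of `T_f − μ_a`): `dim S_n(x) + 2(n+1) + 2 = (n+3)·C(2n,n)`.
[cite: BuchweitzFlenner2008HH, Prop. 6.4.4] [cite: vanGeemen1994HodgeAV, 4.9 and Lemma 5.2] -/
theorem finrank_S_leading_middle_pin_of_det_eq_zero (hA : IsSmoothProjective A.dim A.X) {n a k d : ℕ} (hn : n = a + k + a) (heven : Even n)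
    (hk : 0 < k) (hdim : A.dim = n + n) (hd : 0 < d)
    {φ : A ⟶ A} (hφ : φ ≫ φ = -(d • 𝟙 A)) {P Q : Submodule ℂ (complexBetti A.X 1)}
    (hP : P = Module.End.eigenspace (complexBetti.map φ.hom.hom.hom 1).hom (Complex.I * (Real.sqrt d : ℂ)))
    (hQ : Q = Module.End.eigenspace (complexBetti.map φ.hom.hom.hom 1).hom (-(Complex.I * (Real.sqrt d : ℂ))))
    (hp : finrank ℂ ↥(P ⊓ hodgeOneZero hA) = n) {h : complexBetti A.X 2}
    (hh : complexBetti.map φ.hom.hom.hom 2 h = (d : ℂ) • h) (h11 : IsOfHodgeType A.dim A.X 2 1 1 h)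
    (hvol : ((⋀[ℂ]^2 (complexBetti A.X 1)).subtype ((abelianVarietyCohomologyExteriorH1_holds.equiv A 2).symm h)) ^ (n + n) ≠ 0)
    {cP cQ : complexBetti A.X (2 * n)} (hcP : cP ∈ weilClassesPlus A φ n d) (hcP0 : cP ≠ 0)
    (hcQ : cQ ∈ weilClassesMinus A φ n d) (hcQ0 : cQ ≠ 0)
    {q : ℕ → ℂ} (hq0 : ∀ m, m < n → q m = 0) (hqn : q n ≠ 0) {t : ℂ}
    (ht : (((n + n).factorial : ℕ) : ℂ) •
        ((⋀[ℂ]^(2 * n) (complexBetti A.X 1)).subtype ((abelianVarietyCohomologyExteriorH1_holds.equiv A (2 * n)).symm cP) *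
          (⋀[ℂ]^(2 * n) (complexBetti A.X 1)).subtype ((abelianVarietyCohomologyExteriorH1_holds.equiv A (2 * n)).symm cQ)) =
      t • ((⋀[ℂ]^2 (complexBetti A.X 1)).subtype ((abelianVarietyCohomologyExteriorH1_holds.equiv A 2).symm h)) ^ (n + n))
    (hpin : t = (-1 : ℂ) ^ n * ((n.choose a : ℂ) * (n.choose a : ℂ)) * (q n * q n))
    {μ : ℂ} (hμ : μ = (-1 : ℂ) ^ a * (n.choose a : ℂ) * q n) {B : Matrix (Fin k) (Fin k) ℂ}
    (hB : B = Matrix.of fun r s : Fin k =>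
      (Mod4.hankelT n q - μ • (1 : Matrix (Fin (n + 1)) (Fin (n + 1)) ℂ)) ⟨a + r, by omega⟩ ⟨a + 1 + s, by omega⟩)
    (hdet : B.det = 0) :
    finrank ℂ ↥(S ℂ (hodgeZeroOne hA) n
        ((∑ m ∈ Finset.range (n + n + 1), (q m * ((m.factorial : ℕ) : ℂ)⁻¹) •
            ((⋀[ℂ]^2 (complexBetti A.X 1)).subtype ((abelianVarietyCohomologyExteriorH1_holds.equiv A 2).symm h)) ^ m) +
          (⋀[ℂ]^(2 * n) (complexBetti A.X 1)).subtype ((abelianVarietyCohomologyExteriorH1_holds.equiv A (2 * n)).symm cP) +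
          (⋀[ℂ]^(2 * n) (complexBetti A.X 1)).subtype ((abelianVarietyCohomologyExteriorH1_holds.equiv A (2 * n)).symm cQ))) +
        2 * (n + 1) + 2 = (n + 3) * (n + n).choose n := by
  haveI : Module.Finite ℂ (complexBetti A.X 1) := abelianVarietyCohomologyExteriorH1_holds.finite_one A
  have h := finrank_S_weilType_middle hA hdim hd hφ hP hQ hp hh h11 hvol hcP hcP0 hcQ hcQ0 (by omega) q ht
  rw [Mod4.hankel1_rank_leading_middle hq0 hqn,
    Mod4.finrank_ker_middleM_leading_pin_of_det_eq_zero hn heven hq0 hqn hμ hpin hB hdet] at h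
  have e : (n + 1 + 2) * (n + n).choose n = (n + 3) * (n + n).choose n := by ring
  omega

/-- **any pin of an even `n`, GENERIC pin block, on the real carrier** (`n = a + k + a` even, `t = (−1)ⁿ C(n,a)² q_n²`,
`det B ≠ 0` for the `k × k` pin block `B` of `T_f − μ_a`): `dim S_n(x) + 2(n+1) + 1 = (n+3)·C(2n,n)`.
[cite: BuchweitzFlenner2008HH, Prop. 6.4.4] [cite: vanGeemen1994HodgeAV, 4.9 and Lemma 5.2] -/
theorem finrank_S_leading_middle_pin_of_det_ne_zero (hA : IsSmoothProjective A.dim A.X) {n a k d : ℕ} (hn : n = a + k + a) (heven : Even n)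
    (hk : 0 < k) (hdim : A.dim = n + n) (hd : 0 < d)
    {φ : A ⟶ A} (hφ : φ ≫ φ = -(d • 𝟙 A)) {P Q : Submodule ℂ (complexBetti A.X 1)}
    (hP : P = Module.End.eigenspace (complexBetti.map φ.hom.hom.hom 1).hom (Complex.I * (Real.sqrt d : ℂ)))
    (hQ : Q = Module.End.eigenspace (complexBetti.map φ.hom.hom.hom 1).hom (-(Complex.I * (Real.sqrt d : ℂ))))
    (hp : finrank ℂ ↥(P ⊓ hodgeOneZero hA) = n) {h : complexBetti A.X 2}
    (hh : complexBetti.map φ.hom.hom.hom 2 h = (d : ℂ) • h) (h11 : IsOfHodgeType A.dim A.X 2 1 1 h)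
    (hvol : ((⋀[ℂ]^2 (complexBetti A.X 1)).subtype ((abelianVarietyCohomologyExteriorH1_holds.equiv A 2).symm h)) ^ (n + n) ≠ 0)
    {cP cQ : complexBetti A.X (2 * n)} (hcP : cP ∈ weilClassesPlus A φ n d) (hcP0 : cP ≠ 0)
    (hcQ : cQ ∈ weilClassesMinus A φ n d) (hcQ0 : cQ ≠ 0)
    {q : ℕ → ℂ} (hq0 : ∀ m, m < n → q m = 0) (hqn : q n ≠ 0) {t : ℂ}
    (ht : (((n + n).factorial : ℕ) : ℂ) •
        ((⋀[ℂ]^(2 * n) (complexBetti A.X 1)).subtype ((abelianVarietyCohomologyExteriorH1_holds.equiv A (2 * n)).symm cP) *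
          (⋀[ℂ]^(2 * n) (complexBetti A.X 1)).subtype ((abelianVarietyCohomologyExteriorH1_holds.equiv A (2 * n)).symm cQ)) =
      t • ((⋀[ℂ]^2 (complexBetti A.X 1)).subtype ((abelianVarietyCohomologyExteriorH1_holds.equiv A 2).symm h)) ^ (n + n))
    (hpin : t = (-1 : ℂ) ^ n * ((n.choose a : ℂ) * (n.choose a : ℂ)) * (q n * q n))
    {μ : ℂ} (hμ : μ = (-1 : ℂ) ^ a * (n.choose a : ℂ) * q n) {B : Matrix (Fin k) (Fin k) ℂ}
    (hB : B = Matrix.of fun r s : Fin k =>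
      (Mod4.hankelT n q - μ • (1 : Matrix (Fin (n + 1)) (Fin (n + 1)) ℂ)) ⟨a + r, by omega⟩ ⟨a + 1 + s, by omega⟩)
    (hdet : B.det ≠ 0) :
    finrank ℂ ↥(S ℂ (hodgeZeroOne hA) n
        ((∑ m ∈ Finset.range (n + n + 1), (q m * ((m.factorial : ℕ) : ℂ)⁻¹) •
            ((⋀[ℂ]^2 (complexBetti A.X 1)).subtype ((abelianVarietyCohomologyExteriorH1_holds.equiv A 2).symm h)) ^ m) +
          (⋀[ℂ]^(2 * n) (complexBetti A.X 1)).subtype ((abelianVarietyCohomologyExteriorH1_holds.equiv A (2 * n)).symm cP) +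
          (⋀[ℂ]^(2 * n) (complexBetti A.X 1)).subtype ((abelianVarietyCohomologyExteriorH1_holds.equiv A (2 * n)).symm cQ))) +
        2 * (n + 1) + 1 = (n + 3) * (n + n).choose n := by
  haveI : Module.Finite ℂ (complexBetti A.X 1) := abelianVarietyCohomologyExteriorH1_holds.finite_one A
  have h := finrank_S_weilType_middle hA hdim hd hφ hP hQ hp hh h11 hvol hcP hcP0 hcQ hcQ0 (by omega) q ht
  rw [Mod4.hankel1_rank_leading_middle hq0 hqn,
    Mod4.finrank_ker_middleM_leading_pin_of_det_ne_zero hn heven hq0 hqn hμ hpin hB hdet] at h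
  have e : (n + 1 + 2) * (n + n).choose n = (n + 3) * (n + n).choose n := by ring
  omega

/-- **any pin of an even `n` on the real carrier — THE CRITERION:** `dim S_n(x) + 2(n+1) + 2 = (n+3)·C(2n,n) ↔ det B = 0`
(otherwise the left side with `+ 1` in place of `+ 2` equals the right side).
[cite: BuchweitzFlenner2008HH, Prop. 6.4.4] [cite: vanGeemen1994HodgeAV, 4.9 and Lemma 5.2] -/
theorem finrank_S_leading_middle_pin_iff (hA : IsSmoothProjective A.dim A.X) {n a k d : ℕ} (hn : n = a + k + a) (heven : Even n)
    (hk : 0 < k) (hdim : A.dim = n + n) (hd : 0 < d)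
    {φ : A ⟶ A} (hφ : φ ≫ φ = -(d • 𝟙 A)) {P Q : Submodule ℂ (complexBetti A.X 1)}
    (hP : P = Module.End.eigenspace (complexBetti.map φ.hom.hom.hom 1).hom (Complex.I * (Real.sqrt d : ℂ)))
    (hQ : Q = Module.End.eigenspace (complexBetti.map φ.hom.hom.hom 1).hom (-(Complex.I * (Real.sqrt d : ℂ))))
    (hp : finrank ℂ ↥(P ⊓ hodgeOneZero hA) = n) {h : complexBetti A.X 2}
    (hh : complexBetti.map φ.hom.hom.hom 2 h = (d : ℂ) • h) (h11 : IsOfHodgeType A.dim A.X 2 1 1 h)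
    (hvol : ((⋀[ℂ]^2 (complexBetti A.X 1)).subtype ((abelianVarietyCohomologyExteriorH1_holds.equiv A 2).symm h)) ^ (n + n) ≠ 0)
    {cP cQ : complexBetti A.X (2 * n)} (hcP : cP ∈ weilClassesPlus A φ n d) (hcP0 : cP ≠ 0)
    (hcQ : cQ ∈ weilClassesMinus A φ n d) (hcQ0 : cQ ≠ 0)
    {q : ℕ → ℂ} (hq0 : ∀ m, m < n → q m = 0) (hqn : q n ≠ 0) {t : ℂ}
    (ht : (((n + n).factorial : ℕ) : ℂ) •
        ((⋀[ℂ]^(2 * n) (complexBetti A.X 1)).subtype ((abelianVarietyCohomologyExteriorH1_holds.equiv A (2 * n)).symm cP) *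
          (⋀[ℂ]^(2 * n) (complexBetti A.X 1)).subtype ((abelianVarietyCohomologyExteriorH1_holds.equiv A (2 * n)).symm cQ)) =
      t • ((⋀[ℂ]^2 (complexBetti A.X 1)).subtype ((abelianVarietyCohomologyExteriorH1_holds.equiv A 2).symm h)) ^ (n + n))
    (hpin : t = (-1 : ℂ) ^ n * ((n.choose a : ℂ) * (n.choose a : ℂ)) * (q n * q n))
    {μ : ℂ} (hμ : μ = (-1 : ℂ) ^ a * (n.choose a : ℂ) * q n) {B : Matrix (Fin k) (Fin k) ℂ}
    (hB : B = Matrix.of fun r s : Fin k =>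
      (Mod4.hankelT n q - μ • (1 : Matrix (Fin (n + 1)) (Fin (n + 1)) ℂ)) ⟨a + r, by omega⟩ ⟨a + 1 + s, by omega⟩) :
    finrank ℂ ↥(S ℂ (hodgeZeroOne hA) n
        ((∑ m ∈ Finset.range (n + n + 1), (q m * ((m.factorial : ℕ) : ℂ)⁻¹) •
            ((⋀[ℂ]^2 (complexBetti A.X 1)).subtype ((abelianVarietyCohomologyExteriorH1_holds.equiv A 2).symm h)) ^ m) +
          (⋀[ℂ]^(2 * n) (complexBetti A.X 1)).subtype ((abelianVarietyCohomologyExteriorH1_holds.equiv A (2 * n)).symm cP) +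
          (⋀[ℂ]^(2 * n) (complexBetti A.X 1)).subtype ((abelianVarietyCohomologyExteriorH1_holds.equiv A (2 * n)).symm cQ))) +
        2 * (n + 1) + 2 = (n + 3) * (n + n).choose n ↔ B.det = 0 := by
  constructor
  · intro h
    by_contra hdet
    have h1 := finrank_S_leading_middle_pin_of_det_ne_zero hA hn heven hk hdim hd hφ hP hQ hp hh h11 hvol hcP hcP0 hcQ hcQ0 hq0 hqn
      ht hpin hμ hB hdet
    omega
  · exact finrank_S_leading_middle_pin_of_det_eq_zero hA hn heven hk hdim hd hφ hP hQ hp hh h11 hvol hcP hcP0 hcQ hcQ0 hq0 hqn ht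
      hpin hμ hB

end RealCarrier

end Summit.Ventures.HSemireg.WeilFrame

end
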